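import Mathlib
import HarnessLib
import Summits.HubbardSuperconductivity.HubbardSuperconductivity.Theorems.KLProgrammeSWaveCascadeEdgeAlgebra

/-!
# Route `KLProgramme` — the s-wave-dressed Cooper cascade with SIGNED ladder weights and NO net-mass floor
# (row 0′ of child 1 under the Δ21 text of record `PairLadderStepAtV8`: ℓ¹ mass `≤ bhi`, negative mass edge-localised, net mass free)

Cell gate-hubbard-kl, seat hubbard-kl-k3c1-p2 (child 1 `BetaSplitP`, technique «row-0′ V4/S twin induction measured from its own constant»).
Sequel to `sWaveCascade_envelope_signed` (`…SWaveCascadeSigned`, p469549) — proof adapted from that file — dropping the hypothesis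
`0 ≤ W_n` on the net masses: the Δ21 clause of record (p1 g7, cell STATUS 2026-08-26T21:52:53Z) controls only the ℓ¹ mass `m_n = Σ|w_n|` and
(twice) the negative mass `ν_n := m_n − W_n = Σ(|w_n| − w_n)`, so `W_n ≥ −ν_n` is all there is.  What changes: the scalar cascade
`U_{n+1} = U_n/(1 + W_n U_n)` is no longer monotone but obeys `0 ≤ U_n ≤ (16/15)·U_0` under `16·U_0·Σ_{j<N} ν_j ≤ 1` (`sWaveFloor_*`); the
row / column / scalar channels obey `‖R_n‖ ≤ γ_n k_n`, `‖C_n‖, ‖σ_n‖ ≤ γ_n (k_n + r)` with per-step factors `1 + Ūν_n`, `1 + 2Ūν_n`,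
`(1 + Ūν_n)(1 + 2Ūν_n)` (`Ū = (16/15)U_0`), all `≤ (1 + 2Ūν_n)²`, and `γ_n := (1 − 6Ū·Σ_{j<n} ν_j)⁻¹ ≤ 5/3`; hence again `esup 𝒟_n ≤ 6(k_n + r)`
and the implicit Gronwall lemma with coefficient `42` and masses `m_n` closes with the SAME output constant `12`.

**`sWaveCascade_envelope_edge`**: weights `w_n : S → ℝ` (any sign, any net mass), `U_0 ≥ 0` and `U_{n+1} = U_n/(1 + W_n U_n)`, steps
`𝒞_{n+1} = 𝒞_n − 𝒞_{n+1} ∗_{w_n} 𝒞_n + (E_n + col c_n)` (`n < N`) with `‖E_n(s,t)‖ ≤ e_n(s,t) + r·m_n·esup 𝒟_n`, `‖𝒟_0(s,t)‖ + Σ_{j<N} e_j(s,t) ≤ a`,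
`‖c_n(s)‖ ≤ U_n·m_n·r`, the negative-mass line `16·U_0·Σ_{j<N}(m_j − W_j) ≤ 1` and the smallness `8·42·(a + r)·Σ_{j<N} m_j ≤ 1` ⟹
`0 ≤ U_n ≤ (16/15)·U_0` and `esup (𝒞_n − U_n J) ≤ 12·(a + r)` for every `n ≤ N`.  Everything is proved; no definitions.
-/

noncomputable section

namespace Summit.HubbardSuperconductivity.HubbardSuperconductivity.Theorems.SWaveCascade

set_option linter.dupNamespace false -- summit = problem name (single-conjunct summit), D-0017

open Finset

variable {S : Type*} [Fintype S]

/-- **The envelope of the s-wave-dressed cascade with SIGNED weights and NO net-mass floor.**  See the module docstring.  Hypotheses: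
`U_0 ≥ 0` and the exact cascade `U_{n+1} = U_n/(1 + W_n U_n)` (`W_n = Σ_u w_n(u)` of either sign); the implicit steps with tails `E_n + col c_n`;
the core tails bounded ENTRYWISE by `e_n(s,t)` plus `r·m_n·esup 𝒟_n` (`m_n = Σ_u |w_n(u)|`); the entrywise budget `a`; the column sources
`‖c_n(s)‖ ≤ U_n·m_n·r`; the negative-mass line `16·U_0·Σ_{j<N}(m_j − W_j) ≤ 1`; the smallness `8·42·(a+r)·Σ_{j<N} m_j ≤ 1`.  Conclusion:
`0 ≤ U_n ≤ (16/15)·U_0` and `esup (𝒞_n − U_n J) ≤ 12·(a + r)` for all `n ≤ N`. -/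
theorem sWaveCascade_envelope_edge {w : ℕ → S → ℝ} {𝒞 E : ℕ → S → S → ℂ} {c : ℕ → S → ℂ}
    {e : ℕ → S → S → ℝ} {U : ℕ → ℝ} {N : ℕ} {a r : ℝ}
    (hU0 : 0 ≤ U 0) (hU : ∀ n, U (n + 1) = U n / (1 + (∑ u, w n u) * U n))
    (hstep : ∀ n < N, 𝒞 (n + 1) = 𝒞 n - wmul (w n) (𝒞 (n + 1)) (𝒞 n) + (E n + fun s _ => c n s))
    (he : ∀ n s t, 0 ≤ e n s t)
    (hE : ∀ n < N, ∀ s t, ‖E n s t‖ ≤ e n s t + r * (∑ u, |w n u|) * esup (𝒞 n - ((U n : ℝ) : ℂ) • onesArr))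
    (ha0 : 0 ≤ a) (ha : ∀ s t, ‖𝒞 0 s t - ((U 0 : ℝ) : ℂ)‖ + ∑ j ∈ range N, e j s t ≤ a)
    (hr : 0 ≤ r) (hc : ∀ n < N, ∀ s, ‖c n s‖ ≤ U n * (∑ u, |w n u|) * r)
    (hneg : 16 * U 0 * ∑ j ∈ range N, ((∑ u, |w j u|) - ∑ u, w j u) ≤ 1)
    (hsmall : 8 * 42 * (a + r) * ∑ j ∈ range N, (∑ u, |w j u|) ≤ 1) :
    ∀ n ≤ N, (0 ≤ U n ∧ U n ≤ 16 / 15 * U 0) ∧ esup (𝒞 n - ((U n : ℝ) : ℂ) • onesArr) ≤ 12 * (a + r) := by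
  set Wn : ℕ → ℝ := fun n => ∑ u, w n u with hWn
  set mn : ℕ → ℝ := fun n => ∑ u, |w n u| with hmn
  have hWm : ∀ n, Wn n ≤ mn n := fun n => sum_le_sum_abs (w n)
  have hmn0 : ∀ n, 0 ≤ mn n := fun n => sum_nonneg fun u _ => abs_nonneg _
  set νn : ℕ → ℝ := fun n => mn n - Wn n with hνn
  have hνn0 : ∀ n, 0 ≤ νn n := fun n => by simp only [hνn]; linarith [hWm n]
  have hmWν : ∀ n, mn n = Wn n + νn n := fun n => by simp only [hνn]; ring
  have hWν : ∀ n, -νn n ≤ Wn n := fun n => by simp only [hνn]; linarith [hmn0 n]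
  -- the scalar cascade with the negative-mass floor: `0 ≤ U_n ≤ Ū := (16/15) U_0`
  have hU' : ∀ n, U (n + 1) = U n / (1 + Wn n * U n) := fun n => by rw [hU n]
  have hneg' : 16 * U 0 * ∑ j ∈ range N, νn j ≤ 1 := by simp only [hνn, hmn, hWn]; exact hneg
  set Ub : ℝ := 16 / 15 * U 0 with hUb
  have hUb0 : 0 ≤ Ub := by rw [hUb]; positivity
  have hfb := sWaveFloor_bounds hU0 hU' hWν hνn0 hneg'
  have hfs := sWaveFloor_step hU0 hU' hWν hνn0 hneg'
  have hUn : ∀ n ≤ N, 0 ≤ U n := fun n hn => (hfb n hn).1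
  have hUle : ∀ n ≤ N, U n ≤ Ub := fun n hn => (hfb n hn).2
  have hrel : ∀ n < N, U (n + 1) * (1 + Wn n * U n) = U n := fun n hn => (hfs n hn).2.1
  -- the growth factors `γ_n = (1 − 6·Ū·Σ_{j<n} ν_j)⁻¹ ≤ 5/3`
  set sy : ℕ → ℝ := fun n => ∑ j ∈ range n, Ub * νn j with hsy
  have hy0 : ∀ j, 0 ≤ Ub * νn j := fun j => mul_nonneg hUb0 (hνn0 j)
  have hsy0 : ∀ n, 0 ≤ sy n := fun n => sum_nonneg fun j _ => hy0 j
  have hsy_succ : ∀ n, sy (n + 1) = sy n + Ub * νn n := fun n => by simp only [hsy, sum_range_succ]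
  have hsyN : sy N ≤ 1 / 15 := by
    have : sy N = 16 / 15 * (U 0 * ∑ j ∈ range N, νn j) := by simp only [hsy, hUb, mul_sum]; ring_nf
    rw [this]; linarith
  have hsy_le : ∀ n ≤ N, sy n ≤ 1 / 15 := fun n hn =>
    (sum_le_sum_of_subset_of_nonneg (range_mono hn) fun j _ _ => hy0 j).trans hsyN
  set γ : ℕ → ℝ := fun n => (1 - 6 * sy n)⁻¹ with hγ
  have hγpos : ∀ n ≤ N, 0 < 1 - 6 * sy n := fun n hn => by linarith [hsy_le n hn]
  have hγ1 : ∀ n ≤ N, 1 ≤ γ n := fun n hn => by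
    simp only [hγ]; rw [le_inv_comm₀ one_pos (hγpos n hn), inv_one]; linarith [hsy0 n]
  have hγ0 : ∀ n ≤ N, 0 ≤ γ n := fun n hn => zero_le_one.trans (hγ1 n hn)
  have hγle : ∀ n ≤ N, γ n ≤ 5 / 3 := fun n hn => by
    simp only [hγ]; rw [inv_le_comm₀ (hγpos n hn) (by norm_num)]; linarith [hsy_le n hn]
  have hγstep : ∀ n < N, γ n * (1 + 2 * (Ub * νn n)) ^ 2 ≤ γ (n + 1) := by
    intro n hn
    have hkey := one_add_sq_mul_le (s := 6 * sy n) (by linarith [hy0 n] : 0 ≤ 2 * (Ub * νn n)) (by linarith [hsy0 n])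
    rw [show 1 - 6 * sy n - 3 * (2 * (Ub * νn n)) = 1 - 6 * sy (n + 1) by rw [hsy_succ]; ring] at hkey
    show (1 - 6 * sy n)⁻¹ * (1 + 2 * (Ub * νn n)) ^ 2 ≤ (1 - 6 * sy (n + 1))⁻¹
    rw [inv_mul_le_iff₀ (hγpos n hn.le), ← div_eq_mul_inv, le_div_iff₀ (hγpos (n + 1) (Nat.succ_le_of_lt hn))]
    exact hkey
  have hγstepσ : ∀ n < N, γ n * (1 + Ub * νn n) * (1 + 2 * (Ub * νn n)) ≤ γ (n + 1) := fun n hn => by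
    have h2 : (1 + Ub * νn n) * (1 + 2 * (Ub * νn n)) ≤ (1 + 2 * (Ub * νn n)) ^ 2 := by nlinarith [hy0 n]
    have := mul_le_mul_of_nonneg_left h2 (hγ0 n hn.le)
    rw [mul_assoc]; exact this.trans (hγstep n hn)
  have hγstepC : ∀ n < N, γ n * (1 + 2 * (Ub * νn n)) ≤ γ (n + 1) := fun n hn => by
    have h2 : γ n * (1 + 2 * (Ub * νn n)) ≤ γ n * (1 + Ub * νn n) * (1 + 2 * (Ub * νn n)) := by
      have h := mul_nonneg (mul_nonneg (hγ0 n hn.le) (hy0 n)) (by linarith [hy0 n] : (0 : ℝ) ≤ 1 + 2 * (Ub * νn n))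
      linarith only [h]
    exact h2.trans (hγstepσ n hn)
  have hγstepR : ∀ n < N, γ n * (1 + Ub * νn n) ≤ γ (n + 1) := fun n hn => by
    have h2 : 1 + Ub * νn n ≤ 1 + 2 * (Ub * νn n) := by linarith [hy0 n]
    exact (mul_le_mul_of_nonneg_left h2 (hγ0 n hn.le)).trans (hγstepC n hn)
  set 𝒟 : ℕ → S → S → ℂ := fun n => 𝒞 n - ((U n : ℝ) : ℂ) • onesArr with h𝒟
  set Ec : ℕ → S → S → ℂ := fun n => E n - wmul (w n) (𝒟 (n + 1)) (𝒟 n) with hEc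
  set K : ℕ → S → S → ℂ := fun n => 𝒟 0 + ∑ j ∈ range n, Ec j with hK
  set q : ℕ → ℝ := fun n => ∑ j ∈ range n, (r * mn j * esup (𝒟 j) + esup (𝒟 (j + 1)) * mn j * esup (𝒟 j)) with hq
  set k : ℕ → ℝ := fun n => a + q n with hk
  have hq_term0 : ∀ j, 0 ≤ r * mn j * esup (𝒟 j) + esup (𝒟 (j + 1)) * mn j * esup (𝒟 j) := fun j =>
    add_nonneg (mul_nonneg (mul_nonneg hr (hmn0 j)) (esup_nonneg _))
      (mul_nonneg (mul_nonneg (esup_nonneg _) (hmn0 j)) (esup_nonneg _))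
  have hK_succ : ∀ n, K (n + 1) = K n + Ec n := fun n => by simp only [hK, sum_range_succ]; abel
  have hq_succ : ∀ n, q (n + 1) = q n + (r * mn n * esup (𝒟 n) + esup (𝒟 (n + 1)) * mn n * esup (𝒟 n)) := fun n => by
    simp only [hq, sum_range_succ]
  have hk_succ : ∀ n, k (n + 1) = k n + (r * mn n * esup (𝒟 n) + esup (𝒟 (n + 1)) * mn n * esup (𝒟 n)) := fun n => by
    show a + q (n + 1) = (a + q n) + _; rw [hq_succ]; ring
  have hk_mono : ∀ n, k n ≤ k (n + 1) := fun n => by rw [hk_succ]; linarith [hq_term0 n]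
  have hq0' : ∀ n, 0 ≤ q n := fun n => sum_nonneg fun j _ => hq_term0 j
  have hk0 : ∀ n, 0 ≤ k n := fun n => add_nonneg ha0 (hq0' n)
  have hka : ∀ n, a ≤ k n := fun n => by simp only [hk]; linarith [hq0' n]
  -- the core is bounded ENTRYWISE by `k` (sup outside the scale sum)
  have hKk : ∀ n ≤ N, ∀ s t, ‖K n s t‖ ≤ k n := by
    intro n hn s t
    have h1 : ‖K n s t‖ ≤ ‖𝒟 0 s t‖ + ∑ j ∈ range n, ‖Ec j s t‖ := by
      simp only [hK, Pi.add_apply, Finset.sum_apply]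
      exact (norm_add_le _ _).trans (add_le_add le_rfl (norm_sum_le _ _))
    have h2 : ∀ j ∈ range n, ‖Ec j s t‖ ≤ e j s t + (r * mn j * esup (𝒟 j) + esup (𝒟 (j + 1)) * mn j * esup (𝒟 j)) := by
      intro j hj
      have hjN : j < N := lt_of_lt_of_le (mem_range.1 hj) hn
      have hw1 := hE j hjN s t
      have hw2 : ‖wmul (w j) (𝒟 (j + 1)) (𝒟 j) s t‖ ≤ esup (𝒟 (j + 1)) * mn j * esup (𝒟 j) :=
        (le_esup _ s t).trans (esup_wmul_le_abs (w j) _ _)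
      calc ‖Ec j s t‖ = ‖E j s t - wmul (w j) (𝒟 (j + 1)) (𝒟 j) s t‖ := rfl
        _ ≤ ‖E j s t‖ + ‖wmul (w j) (𝒟 (j + 1)) (𝒟 j) s t‖ := norm_sub_le _ _
        _ ≤ _ := by linarith
    have h3 : ∑ j ∈ range n, ‖Ec j s t‖ ≤ ∑ j ∈ range n, e j s t + q n := by
      rw [hq, ← sum_add_distrib]; exact sum_le_sum h2
    have h4 : ∑ j ∈ range n, e j s t ≤ ∑ j ∈ range N, e j s t :=
      sum_le_sum_of_subset_of_nonneg (range_mono hn) fun j _ _ => he j s t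
    have h5 := ha s t
    have h6 : ‖𝒟 0 s t‖ = ‖𝒞 0 s t - ((U 0 : ℝ) : ℂ)‖ := by
      simp only [h𝒟, Pi.sub_apply, Pi.smul_apply, onesArr, smul_eq_mul, mul_one]
    show ‖K n s t‖ ≤ a + q n; linarith
  have hstar : ∀ n < N, 𝒟 (n + 1) + ((U n : ℝ) : ℂ) • wmul (w n) (𝒟 (n + 1)) onesArr =
      𝒟 n - ((U (n + 1) : ℝ) : ℂ) • wmul (w n) onesArr (𝒟 n) + (Ec n + fun s _ => c n s) := by
    intro n hn
    rw [step_decompose' (w n) (hstep n hn) (hrel n hn) rfl rfl]; congr 1; simp only [hEc]; abel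
  -- the row / column / scalar recursion (column channel WITH source)
  set ρ : ℕ → S → ℂ := fun n t => ∑ u, (w n u : ℂ) * K n u t with hρ
  set κ : ℕ → S → ℂ := fun n s => ∑ u, K (n + 1) s u * (w n u : ℂ) with hκ
  set F : ℕ → (S → ℂ) × (S → ℂ) × ℂ → (S → ℂ) × (S → ℂ) × ℂ := fun n X =>
    ( fun t => (((1 - U (n + 1) * Wn n : ℝ)) : ℂ) * X.1 t - ((U (n + 1) : ℝ) : ℂ) * ρ n t,
      fun s => (X.2.1 s - ((U n : ℝ) : ℂ) * κ n s + c n s) / (((1 + U n * Wn n : ℝ)) : ℂ),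
      (X.2.2 * (((1 - U (n + 1) * Wn n : ℝ)) : ℂ) - ((U (n + 1) : ℝ) : ℂ) * (∑ u, (w n u : ℂ) * X.2.1 u) -
        ((U n : ℝ) : ℂ) * (∑ u, ((((1 - U (n + 1) * Wn n : ℝ)) : ℂ) * X.1 u - ((U (n + 1) : ℝ) : ℂ) * ρ n u) * (w n u : ℂ))) /
        (((1 + U n * Wn n : ℝ)) : ℂ) ) with hF
  obtain ⟨X, hX0, hXs⟩ : ∃ X : ℕ → (S → ℂ) × (S → ℂ) × ℂ, X 0 = (0, 0, 0) ∧ ∀ n, X (n + 1) = F n (X n) :=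
    ⟨fun n => Nat.rec ((0 : S → ℂ), (0 : S → ℂ), (0 : ℂ)) F n, rfl, fun n => rfl⟩
  have hden' : ∀ n < N, (0 : ℝ) < 1 + U n * Wn n := fun n hn => by rw [mul_comm]; exact (hfs n hn).1
  have hden : ∀ n < N, (((1 + U n * Wn n : ℝ)) : ℂ) ≠ 0 := fun n hn => by exact_mod_cast (hden' n hn).ne'
  have eR : ∀ n t, (X (n + 1)).1 t =
      (((1 - U (n + 1) * Wn n : ℝ)) : ℂ) * (X n).1 t - ((U (n + 1) : ℝ) : ℂ) * ρ n t := fun n t => by rw [hXs n]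
  have eC : ∀ n < N, ∀ s, (X (n + 1)).2.1 s * (((1 + U n * Wn n : ℝ)) : ℂ) = (X n).2.1 s - ((U n : ℝ) : ℂ) * κ n s + c n s :=
    fun n hn s => by rw [hXs n]; exact div_mul_cancel₀ _ (hden n hn)
  have eσ : ∀ n < N, (X (n + 1)).2.2 * (((1 + U n * Wn n : ℝ)) : ℂ) =
      (X n).2.2 * (((1 - U (n + 1) * Wn n : ℝ)) : ℂ) - ((U (n + 1) : ℝ) : ℂ) * (∑ u, (w n u : ℂ) * (X n).2.1 u) -
        ((U n : ℝ) : ℂ) * (∑ u, (X (n + 1)).1 u * (w n u : ℂ)) := fun n hn => by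
    have h1 : (X (n + 1)).2.2 = (F n (X n)).2.2 := by rw [hXs n]
    have h2 : ∀ u, (X (n + 1)).1 u = (F n (X n)).1 u := fun u => by rw [hXs n]
    rw [h1]; simp only [hF]; rw [div_mul_cancel₀ _ (hden n hn)]
    congr 1; congr 1; exact sum_congr rfl fun u _ => by rw [h2 u]
  -- MAIN INDUCTION: decomposition + bounds (`|R| ≤ γ k`, `|C|, |σ| ≤ γ (k + r)`)
  have main : ∀ n ≤ N, 𝒟 n = K n + (fun _ t => (X n).1 t) + (fun s _ => (X n).2.1 s) + (X n).2.2 • onesArr ∧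
      (∀ t, ‖(X n).1 t‖ ≤ γ n * k n) ∧ (∀ s, ‖(X n).2.1 s‖ ≤ γ n * (k n + r)) ∧ ‖(X n).2.2‖ ≤ γ n * (k n + r) := by
    intro n
    induction n with
    | zero =>
      intro _; have hγ00 := hγ0 0 (Nat.zero_le N)
      refine ⟨?_, fun t => ?_, fun s => ?_, ?_⟩
      · funext s t; simp [hK, hX0]
      · simp only [hX0, Pi.zero_apply, norm_zero]; exact mul_nonneg hγ00 (hk0 0)
      · simp only [hX0, Pi.zero_apply, norm_zero]; exact mul_nonneg hγ00 (add_nonneg (hk0 0) hr)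
      · simp only [hX0, norm_zero]; exact mul_nonneg hγ00 (add_nonneg (hk0 0) hr)
    | succ n ih =>
      intro hn
      have hn' : n < N := Nat.lt_of_succ_le hn
      obtain ⟨hdec, hR, hC, hσ⟩ := ih hn'.le
      have hUnn := hUn n hn'.le; have hUn1 := hUn (n + 1) hn
      have hpos : 0 < 1 + U n * Wn n := hden' n hn'
      have hα'1' : U (n + 1) * Wn n ≤ 1 := by rw [mul_comm]; exact (hfs n hn').2.2.1
      have hγn0 := hγ0 n hn'.le; have hγn1 := hγ1 n hn'.le
      have hkn := hk_mono n; have hkn0 := hk0 n; have hk'0 := hk0 (n + 1)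
      have hmn0n := hmn0 n; have hy0n := hy0 n
      -- the per-step factors `U_n ν_n, U_{n+1} ν_n ≤ Ū ν_n ≤ 1/15`
      have hνU : U n * νn n ≤ Ub * νn n := mul_le_mul_of_nonneg_right (hUle n hn'.le) (hνn0 n)
      have hνU' : U (n + 1) * νn n ≤ Ub * νn n := mul_le_mul_of_nonneg_right (hUle (n + 1) hn) (hνn0 n)
      have hνUs : U n * νn n ≤ 1 / 15 := by rw [mul_comm]; exact (hfs n hn').2.2.2
      have hgR := hγstepR n hn'; have hgC := hγstepC n hn'; have hgσ := hγstepσ n hn'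
      -- (1) the decomposition at n+1: candidate and uniqueness
      set Xc : S → S → ℂ := K (n + 1) + (fun _ t => (X (n + 1)).1 t) + (fun s _ => (X (n + 1)).2.1 s) +
        (X (n + 1)).2.2 • onesArr with hXc
      have hcand : Xc + ((U n : ℝ) : ℂ) • wmul (w n) Xc onesArr =
          𝒟 n - ((U (n + 1) : ℝ) : ℂ) • wmul (w n) onesArr (𝒟 n) + (Ec n + fun s _ => c n s) := by
        rw [hdec]; funext s t
        simp only [hXc, Pi.add_apply, Pi.sub_apply, Pi.smul_apply, smul_eq_mul, wmul_decomp_onesArr, onesArr_wmul_decomp,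
          onesArr, mul_one, hK_succ]
        have e1 := eR n t; have e2 := eC n hn' s; have e3 := eσ n hn'
        have eκ : κ n s = ∑ u, K (n + 1) s u * (w n u : ℂ) := rfl
        have eρ : ρ n t = ∑ u, (w n u : ℂ) * K n u t := rfl
        rw [hK_succ] at eκ; simp only [Pi.add_apply] at eκ
        have eW : (∑ u, (w n u : ℂ)) = ((Wn n : ℝ) : ℂ) := by rw [hWn]; push_cast; rfl
        rw [eW]; rw [eκ] at e2; rw [eρ] at e1
        push_cast at e1 e2 e3 ⊢
        linear_combination e1 + e2 + e3
      have hdiff : (𝒟 (n + 1) - Xc) + ((U n : ℝ) : ℂ) • wmul (w n) (𝒟 (n + 1) - Xc) onesArr = 0 := by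
        rw [wmul_sub_left, smul_sub, ← sub_eq_zero]
        have := hstar n hn'; have h2 := hcand
        calc 𝒟 (n + 1) - Xc + (((U n : ℝ) : ℂ) • wmul (w n) (𝒟 (n + 1)) onesArr - ((U n : ℝ) : ℂ) • wmul (w n) Xc onesArr) - 0
            = (𝒟 (n + 1) + ((U n : ℝ) : ℂ) • wmul (w n) (𝒟 (n + 1)) onesArr) -
                (Xc + ((U n : ℝ) : ℂ) • wmul (w n) Xc onesArr) := by abel
          _ = 0 := by rw [this, h2, sub_self]
      have hdec' : 𝒟 (n + 1) = Xc := sub_eq_zero.1 (eq_zero_of_add_smul_wmul_onesArr_of_pos hpos hdiff)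
      -- (2) the bounds (ℓ¹ masses `mn = Wn + νn` in the feeding terms)
      have hρb : ∀ t, ‖ρ n t‖ ≤ mn n * k n := fun t =>
        (norm_sum_mul_le_abs' (w := w n) (fun u => hKk n hn'.le u t)).trans le_rfl
      have hκb : ∀ s, ‖κ n s‖ ≤ mn n * k (n + 1) := fun s =>
        (norm_sum_mul_le_abs (w := w n) (fun u => hKk (n + 1) hn s u)).trans le_rfl
      have hkr0 : 0 ≤ k (n + 1) + r := add_nonneg hk'0 hr
      have hkr0' : 0 ≤ k n + r := add_nonneg hkn0 hr
      -- ROW: `(1 − U'W)γk + U'(W+ν)k = γk + U'νγk − U'm(γ−1)k ≤ γ(1 + Ūν)k`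
      have hR' : ∀ t, ‖(X (n + 1)).1 t‖ ≤ γ n * (1 + Ub * νn n) * k (n + 1) := by
        intro t; rw [eR n t]; refine (norm_sub_le _ _).trans ?_
        rw [norm_mul, norm_mul, Complex.norm_real, Complex.norm_real, Real.norm_eq_abs, Real.norm_eq_abs,
          abs_of_nonneg (by linarith), abs_of_nonneg hUn1]
        have h1 : (1 - U (n + 1) * Wn n) * ‖(X n).1 t‖ ≤ (1 - U (n + 1) * Wn n) * (γ n * k n) :=
          mul_le_mul_of_nonneg_left (hR t) (by linarith)
        have h2 : U (n + 1) * ‖ρ n t‖ ≤ U (n + 1) * (mn n * k n) := mul_le_mul_of_nonneg_left (hρb t) hUn1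
        have f4 : U (n + 1) * Wn n * (γ n * k n) = U (n + 1) * mn n * (γ n * k n) - U (n + 1) * νn n * (γ n * k n) := by
          rw [hmWν]; ring
        have hA : 0 ≤ U (n + 1) * mn n * (γ n * k n - k n) :=
          mul_nonneg (mul_nonneg hUn1 hmn0n) (by have := mul_le_mul_of_nonneg_right hγn1 hkn0; linarith only [this])
        have hB : U (n + 1) * νn n * (γ n * k n) ≤ Ub * νn n * (γ n * k n) :=
          mul_le_mul_of_nonneg_right hνU' (mul_nonneg hγn0 hkn0)
        have h6 : γ n * (1 + Ub * νn n) * k n ≤ γ n * (1 + Ub * νn n) * k (n + 1) :=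
          mul_le_mul_of_nonneg_left hkn (mul_nonneg hγn0 (by linarith))
        linarith only [h1, h2, f4, hA, hB, h6]
      have hR'' : ∀ t, ‖(X (n + 1)).1 t‖ ≤ γ (n + 1) * k (n + 1) := fun t => (hR' t).trans (mul_le_mul_of_nonneg_right hgR hk'0)
      -- COLUMN: `γ(k+r) + U(W+ν)(k'+r) ≤ γ(1+2Ūν)(k'+r)(1 + U(W+ν) − Uν)·`, using `Uν ≤ 1/15`
      have hC' : ∀ s, ‖(X (n + 1)).2.1 s‖ ≤ γ n * (1 + 2 * (Ub * νn n)) * (k (n + 1) + r) := by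
        intro s
        have e2 := eC n hn' s
        have hnorm : ‖(X (n + 1)).2.1 s‖ * (1 + U n * Wn n) = ‖(X n).2.1 s - ((U n : ℝ) : ℂ) * κ n s + c n s‖ := by
          rw [← e2, norm_mul, Complex.norm_real, Real.norm_eq_abs, abs_of_nonneg hpos.le]
        have hcs : ‖c n s‖ ≤ U n * mn n * r := hc n hn' s
        have hb : ‖(X n).2.1 s - ((U n : ℝ) : ℂ) * κ n s + c n s‖ ≤
            γ n * (k n + r) + U n * mn n * k (n + 1) + U n * mn n * r := by
          refine (norm_add_le _ _).trans ?_
          refine (add_le_add (norm_sub_le _ _) le_rfl).trans ?_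
          rw [norm_mul, Complex.norm_real, Real.norm_eq_abs, abs_of_nonneg hUnn]
          have := mul_le_mul_of_nonneg_left (hκb s) hUnn
          linarith only [hC s, this, hcs]
        have f1 : γ n * (k n + r) ≤ γ n * (k (n + 1) + r) := mul_le_mul_of_nonneg_left (by linarith) hγn0
        have f2 : U n * mn n * (k (n + 1) + r) ≤ γ n * (U n * mn n * (k (n + 1) + r)) :=
          le_mul_of_one_le_left (mul_nonneg (mul_nonneg hUnn hmn0n) hkr0) hγn1
        have f3 : γ n * (U n * mn n * (k (n + 1) + r)) =
            γ n * U n * Wn n * (k (n + 1) + r) + U n * νn n * (γ n * (k (n + 1) + r)) := by rw [hmWν]; ring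
        have f4 : U n * νn n * (γ n * (k (n + 1) + r)) ≤ Ub * νn n * (γ n * (k (n + 1) + r)) :=
          mul_le_mul_of_nonneg_right hνU (mul_nonneg hγn0 hkr0)
        have f6 : 0 ≤ Ub * νn n * (U n * mn n) * (γ n * (k (n + 1) + r)) :=
          mul_nonneg (mul_nonneg hy0n (mul_nonneg hUnn hmn0n)) (mul_nonneg hγn0 hkr0)
        have f5 : 2 * (Ub * νn n) * (U n * νn n) * (γ n * (k (n + 1) + r)) ≤ Ub * νn n * (γ n * (k (n + 1) + r)) := by
          have h2ν : 2 * (U n * νn n) ≤ 1 := by linarith only [hνUs]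
          have h0 : 0 ≤ Ub * νn n * (γ n * (k (n + 1) + r)) := mul_nonneg hy0n (mul_nonneg hγn0 hkr0)
          calc 2 * (Ub * νn n) * (U n * νn n) * (γ n * (k (n + 1) + r))
              = (2 * (U n * νn n)) * (Ub * νn n * (γ n * (k (n + 1) + r))) := by ring
            _ ≤ 1 * (Ub * νn n * (γ n * (k (n + 1) + r))) := mul_le_mul_of_nonneg_right h2ν h0
            _ = Ub * νn n * (γ n * (k (n + 1) + r)) := one_mul _
        have f7 : Ub * νn n * (γ n * (k (n + 1) + r)) * (U n * Wn n) =
            Ub * νn n * (U n * mn n) * (γ n * (k (n + 1) + r)) - (Ub * νn n) * (U n * νn n) * (γ n * (k (n + 1) + r)) := by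
          rw [hmWν]; ring
        have h' : ‖(X (n + 1)).2.1 s‖ * (1 + U n * Wn n) ≤ (γ n * (1 + 2 * (Ub * νn n)) * (k (n + 1) + r)) * (1 + U n * Wn n) := by
          rw [hnorm]; exact hb.trans (by linarith only [f1, f2, f3, f4, f5, f6, f7])
        exact le_of_mul_le_mul_right h' hpos
      have hC'' : ∀ s, ‖(X (n + 1)).2.1 s‖ ≤ γ (n + 1) * (k (n + 1) + r) := fun s => (hC' s).trans (mul_le_mul_of_nonneg_right hgC hkr0)
      -- SCALAR: `γ(k+r)(1+U'ν) + U m ḡk' ≤ ḡ(k'+r)(1 + Um) ≤ ḡ(1+2Ūν)(k'+r)(1+UW)`, `ḡ = γ(1+Ūν)`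
      have hσ' : ‖(X (n + 1)).2.2‖ ≤ γ (n + 1) * (k (n + 1) + r) := by
        have e3 := eσ n hn'
        have hnorm : ‖(X (n + 1)).2.2‖ * (1 + U n * Wn n) =
            ‖(X n).2.2 * (((1 - U (n + 1) * Wn n : ℝ)) : ℂ) - ((U (n + 1) : ℝ) : ℂ) * (∑ u, (w n u : ℂ) * (X n).2.1 u) -
              ((U n : ℝ) : ℂ) * (∑ u, (X (n + 1)).1 u * (w n u : ℂ))‖ := by
          rw [← e3, norm_mul, Complex.norm_real, Real.norm_eq_abs, abs_of_nonneg hpos.le]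
        set gb : ℝ := γ n * (1 + Ub * νn n) with hgb
        have hgb0 : 0 ≤ gb := mul_nonneg hγn0 (by linarith)
        have hC_avg : ‖∑ u, (w n u : ℂ) * (X n).2.1 u‖ ≤ mn n * (γ n * (k n + r)) := norm_sum_mul_le_abs' hC
        have hR_avg : ‖∑ u, (X (n + 1)).1 u * (w n u : ℂ)‖ ≤ mn n * (gb * k (n + 1)) := norm_sum_mul_le_abs hR'
        have hb : ‖(X n).2.2 * (((1 - U (n + 1) * Wn n : ℝ)) : ℂ) - ((U (n + 1) : ℝ) : ℂ) * (∑ u, (w n u : ℂ) * (X n).2.1 u) -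
              ((U n : ℝ) : ℂ) * (∑ u, (X (n + 1)).1 u * (w n u : ℂ))‖ ≤
            γ n * (k n + r) * (1 - U (n + 1) * Wn n) + U (n + 1) * (mn n * (γ n * (k n + r))) +
              U n * (mn n * (gb * k (n + 1))) := by
          refine (norm_sub_le _ _).trans ?_
          refine (add_le_add (norm_sub_le _ _) le_rfl).trans ?_
          rw [norm_mul, norm_mul, norm_mul, Complex.norm_real, Complex.norm_real, Complex.norm_real, Real.norm_eq_abs,
            Real.norm_eq_abs, Real.norm_eq_abs, abs_of_nonneg (by linarith : (0:ℝ) ≤ 1 - U (n + 1) * Wn n),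
            abs_of_nonneg hUn1, abs_of_nonneg hUnn]
          have h1 : ‖(X n).2.2‖ * (1 - U (n + 1) * Wn n) ≤ γ n * (k n + r) * (1 - U (n + 1) * Wn n) :=
            mul_le_mul_of_nonneg_right hσ (by linarith)
          have h2 : U (n + 1) * ‖∑ u, (w n u : ℂ) * (X n).2.1 u‖ ≤ U (n + 1) * (mn n * (γ n * (k n + r))) :=
            mul_le_mul_of_nonneg_left hC_avg hUn1
          have h3 : U n * ‖∑ u, (X (n + 1)).1 u * (w n u : ℂ)‖ ≤ U n * (mn n * (gb * k (n + 1))) :=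
            mul_le_mul_of_nonneg_left hR_avg hUnn
          linarith only [h1, h2, h3]
        have hb' : γ n * (k n + r) * (1 - U (n + 1) * Wn n) + U (n + 1) * (mn n * (γ n * (k n + r))) +
              U n * (mn n * (gb * k (n + 1))) ≤ gb * (1 + 2 * (Ub * νn n)) * (k (n + 1) + r) * (1 + U n * Wn n) := by
          have t1 : γ n * (k n + r) * (1 - U (n + 1) * Wn n) + U (n + 1) * (mn n * (γ n * (k n + r))) =
              γ n * (k n + r) * (1 + U (n + 1) * νn n) := by rw [hmWν]; ring
          have t2 : γ n * (k n + r) * (1 + U (n + 1) * νn n) ≤ gb * (k (n + 1) + r) := by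
            calc γ n * (k n + r) * (1 + U (n + 1) * νn n) ≤ γ n * (k n + r) * (1 + Ub * νn n) :=
                  mul_le_mul_of_nonneg_left (by linarith only [hνU']) (mul_nonneg hγn0 hkr0')
              _ = gb * (k n + r) := by rw [hgb]; ring
              _ ≤ gb * (k (n + 1) + r) := mul_le_mul_of_nonneg_left (by linarith only [hkn]) hgb0
          have t3 : U n * (mn n * (gb * k (n + 1))) ≤ U n * mn n * (gb * (k (n + 1) + r)) := by
            have s1 : gb * k (n + 1) ≤ gb * (k (n + 1) + r) := mul_le_mul_of_nonneg_left (by linarith only [hr]) hgb0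
            have := mul_le_mul_of_nonneg_left s1 (mul_nonneg hUnn hmn0n)
            linarith only [this]
          -- `(1 + Um) ≤ (1+2Ūν)(1 + Um − Uν)`: from `Uν ≤ Ūν`, `2ŪνUν ≤ Ūν`, `0 ≤ 2ŪνUm`
          have f3 : U n * mn n * (gb * (k (n + 1) + r)) =
              gb * (k (n + 1) + r) * (U n * Wn n) + U n * νn n * (gb * (k (n + 1) + r)) := by rw [hmWν]; ring
          have f4 : U n * νn n * (gb * (k (n + 1) + r)) ≤ Ub * νn n * (gb * (k (n + 1) + r)) :=
            mul_le_mul_of_nonneg_right hνU (mul_nonneg hgb0 hkr0)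
          have f6 : 0 ≤ Ub * νn n * (U n * mn n) * (gb * (k (n + 1) + r)) :=
            mul_nonneg (mul_nonneg hy0n (mul_nonneg hUnn hmn0n)) (mul_nonneg hgb0 hkr0)
          have f5 : 2 * (Ub * νn n) * (U n * νn n) * (gb * (k (n + 1) + r)) ≤ Ub * νn n * (gb * (k (n + 1) + r)) := by
            have h2ν : 2 * (U n * νn n) ≤ 1 := by linarith only [hνUs]
            have h0 : 0 ≤ Ub * νn n * (gb * (k (n + 1) + r)) := mul_nonneg hy0n (mul_nonneg hgb0 hkr0)
            calc 2 * (Ub * νn n) * (U n * νn n) * (gb * (k (n + 1) + r))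
                = (2 * (U n * νn n)) * (Ub * νn n * (gb * (k (n + 1) + r))) := by ring
              _ ≤ 1 * (Ub * νn n * (gb * (k (n + 1) + r))) := mul_le_mul_of_nonneg_right h2ν h0
              _ = Ub * νn n * (gb * (k (n + 1) + r)) := one_mul _
          have f7 : Ub * νn n * (gb * (k (n + 1) + r)) * (U n * Wn n) =
              Ub * νn n * (U n * mn n) * (gb * (k (n + 1) + r)) - (Ub * νn n) * (U n * νn n) * (gb * (k (n + 1) + r)) := by
            rw [hmWν]; ring
          linarith only [t1, t2, t3, f3, f4, f5, f6, f7]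
        have h' : ‖(X (n + 1)).2.2‖ * (1 + U n * Wn n) ≤ (γ (n + 1) * (k (n + 1) + r)) * (1 + U n * Wn n) := by
          rw [hnorm]; refine (hb.trans hb').trans ?_
          exact mul_le_mul_of_nonneg_right (mul_le_mul_of_nonneg_right (by rw [hgb]; exact hgσ) hkr0) hpos.le
        exact le_of_mul_le_mul_right h' hpos
      exact ⟨by rw [hdec'], hR'', hC'', hσ'⟩
  have he6 : ∀ n ≤ N, esup (𝒟 n) ≤ 6 * (k n + r) := by
    intro n hn
    obtain ⟨hdec, hR, hC, hσ⟩ := main n hn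
    have hγn := hγle n hn; have hkr0 : 0 ≤ k n + r := add_nonneg (hk0 n) hr
    refine esup_le (fun s t => ?_) (by linarith [hk0 n])
    rw [hdec]; simp only [Pi.add_apply, Pi.smul_apply, smul_eq_mul, onesArr, mul_one]
    have h1 := hKk n hn s t
    have h2 : γ n * k n ≤ 5 / 3 * (k n + r) :=
      (mul_le_mul_of_nonneg_left (by linarith : k n ≤ k n + r) (hγ0 n hn)).trans (mul_le_mul_of_nonneg_right hγn hkr0)
    have h3 : γ n * (k n + r) ≤ 5 / 3 * (k n + r) := mul_le_mul_of_nonneg_right hγn hkr0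
    calc ‖K n s t + (X n).1 t + (X n).2.1 s + (X n).2.2‖
        ≤ ‖K n s t‖ + ‖(X n).1 t‖ + ‖(X n).2.1 s‖ + ‖(X n).2.2‖ :=
          (norm_add_le _ _).trans (add_le_add ((norm_add_le _ _).trans (add_le_add (norm_add_le _ _) le_rfl)) le_rfl)
      _ ≤ 6 * (k n + r) := by linarith [hR t, hC s, hka n]
  -- Gronwall on `d n := k n + r` with masses `m_n`
  set d : ℕ → ℝ := fun n => k n + r with hd
  have hd0 : ∀ n, 0 ≤ d n := fun n => add_nonneg (hk0 n) hr
  have hdr : ∀ n, r ≤ d n := fun n => by simp only [hd]; linarith [hk0 n]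
  have hd_mono : ∀ n, d n ≤ d (n + 1) := fun n => by simp only [hd]; linarith [hk_mono n]
  have hdstep : ∀ n < N, d (n + 1) * (1 - 42 * mn n * d n) ≤ d n + 0 := by
    intro n hn
    have h1 : esup (𝒟 n) ≤ 6 * d n := by have := he6 n hn.le; simp only [hd]; linarith
    have h2 : esup (𝒟 (n + 1)) ≤ 6 * d (n + 1) := by have := he6 (n + 1) (Nat.succ_le_of_lt hn); simp only [hd]; linarith
    have hinc : d (n + 1) = d n + (r * mn n * esup (𝒟 n) + esup (𝒟 (n + 1)) * mn n * esup (𝒟 n)) := by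
      simp only [hd, hk_succ]; ring
    have h3 : r * mn n * esup (𝒟 n) ≤ d n * mn n * (6 * d n) := by
      have := mul_le_mul (mul_le_mul_of_nonneg_right (hdr n) (hmn0 n)) h1 (esup_nonneg _)
        (mul_nonneg (hd0 n) (hmn0 n))
      linarith
    have h4 : esup (𝒟 (n + 1)) * mn n * esup (𝒟 n) ≤ (6 * d (n + 1)) * mn n * (6 * d n) :=
      mul_le_mul (mul_le_mul_of_nonneg_right h2 (hmn0 n)) h1 (esup_nonneg _)
        (mul_nonneg (by linarith [hd0 (n + 1)]) (hmn0 n))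
    have h5 : d n * mn n * (6 * d n) ≤ d (n + 1) * mn n * (6 * d n) :=
      mul_le_mul_of_nonneg_right (mul_le_mul_of_nonneg_right (hd_mono n) (hmn0 n)) (by linarith [hd0 n])
    linarith [hinc, h3, h4, h5]
  have hd00 : d 0 = a + r := by simp [hd, hk, hq]
  have hsmall' : 8 * 42 * (d 0 + ∑ j ∈ range N, (0 : ℝ)) * ∑ j ∈ range N, mn j ≤ 1 := by
    rw [hd00, sum_const_zero, add_zero]; exact hsmall
  have hG := implicit_gronwall (d := d) (t := fun _ => 0) (b := mn) (K := 42) (by norm_num) hd0 (fun _ => le_rfl) hmn0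
    (fun n hn => by simpa [mul_assoc, mul_comm, mul_left_comm] using hdstep n hn) hsmall'
  intro n hn
  refine ⟨⟨hUn n hn, hUle n hn⟩, ?_⟩
  have hGn := hG n hn; rw [sum_const_zero, add_zero, hd00] at hGn
  calc esup (𝒟 n) ≤ 6 * (k n + r) := he6 n hn
    _ = 6 * d n := by simp only [hd]
    _ ≤ 12 * (a + r) := by linarith

end Summit.HubbardSuperconductivity.HubbardSuperconductivity.Theorems.SWaveCascade

end
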